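import Summits.QuantumFields.YangMills.Theorems.BalabanUVNodesN15CurvedGluingSpeciesCommutator
import HarnessLib

/-!
# Route «BalabanUVNodes» (cluster K4 «SpineRates»), Track-A DAG node N15 = NE2, BACKGROUND LAYER — THE η-DEFECT ROW OF THE SPECIES COMMUTATOR `𝔇([V′, M_{h′}]G′, [V, M_h]G)` FROM
# THE CUBE's ENTRY-0∕1 DEFECTS (three-factor Leibniz), AND BAŁABAN's COVARIANT LAPLACIAN (3.50) AS A LAPLACIAN-TYPE OPERATOR `Δ_R = Σ_μ∇*_μ∇_μ + (−V)` OF THE GLUING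

Cell `pub-ymgap`, seat `pub-ymgap-dag-n15-w3` (WIDTH SEAT 3∕3 on node N15, director-ym №197 ∕ HUMAN RULING D-0149; plan `W-SEAT-START-LIST.md` §n15 item 3 — thirteenth piece, the `r_W`
DEFECT ROW that dag-n15-c g11's FILE 46 `hasMaj_idef_commOp_lapOp_comp` ∕ `hasMaj_idef_glued_of_cubeEntries` display as `hDW`, for `W = ±V`).  `bears_on: R4∕N15 · K3⁷
SpineGivenEndpointR13SepCoPH (stmt-QuantumFields-20544)`.  Filed `--kind proof --supports stmt-QuantumFields-20544 --as helper` — COUNT-NEUTRAL.  Theorems only; 0 `sorry`.  Imports BY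
NAME file 12 `…N15CurvedGluingSpeciesCommutator` (`commOp_speciesOpM_comp`, `hasMaj_commOp_speciesOpM_comp`, `hasMaj_commOp_neg_speciesOpM_comp`; through it dag-n15-c FILE 46
`…N15TwoSpacingGluingCommutator` — `lapDir`, `lapOp`, `hasMaj_mulOp_comp_loc`, `hasMaj_idef_mulOp_comp_loc`, `hasMaj_commOp_lapOp_comp`, `hasMaj_idef_commOp_lapOp_comp`, `idef_fsum`,
`idef_neg`, `hasMaj_diag_comp`, `hasMaj_fsum` — and dag-n15-c FILE 28 `…N15CovariantLaplacianSpecies` — `speciesOpM`, `covLapM`, `tCoefA`, `tCoefC`, `covLapM_one_eq`,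
`covLapM_eq_one_sub_speciesOpM`; n15-b `…N15VectorCarrier` — `mmulOp`, `liftMap`, `liftBlk`, `liftEquiv`, `hasMaj_mmulOp`, `hasMaj_idef_mmulOp`); nothing in the tree is modified.

WHY.  dag-n15-c's gluing at two spacings (FILES 43–50) reads every letter of [Balaban1984PropagatorsII] Prop. 2.6 off the CUBES' entries 0∕1, their two-grid defects, the
partition's smoothness∕fits — and, for the non-Laplacian part `W` of `Δ_a = Σ_μ∇*_μ∇_μ + W`, off two DISPLAYED rows per cube: the commutator letter `[W, M_h]G ≤ 1_S1_S·θ_W·e^{−δd}` (`hW`)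
and its η-defect `𝔇([W′, M_{h′}]G′, [W, M_h]G) ≤ 1_S1_S·r_W·e^{−δd}` (`hDW`).  A first-order species `−V(c, a)` of (3.52)–(3.53) ([Balaban1985BackgroundPropagators] p. 400) enters `W` in
BOTH readings of (3.53): `Δ_{U′U} = Δ_U − V′` (the small-field perturbation around a curved background — file 1 `covLapM_gaugePair_mul_eq`, the `W` of dag-n15-c's covariant gluing
FILE 52 `…TwoSpacingGluingCovariant`) and `Δ_R = Δ_1 − V(c_R, a_R)` (the whole transport read against the flat Laplacian — FILE 28 `covLapM_eq_one_sub_speciesOpM`, §3 below); the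
rows are stated for ARBITRARY coefficients `C, A`, so they serve both.  File 12 supplied `hW` for `W = ±V`.  THIS FILE supplies `hDW`: by file 12's exact expansion
`[V, M_h]G = Σ_μ[M_{A⁺}(M_{∇⁺h}G + M_{δ⁺h}∇⁺G) + M_{A⁻}(M_{∇⁻h}G − M_{δ⁻h}∇⁻G)]` on both grids and the three-factor Leibniz rule
`𝔇(M_{A′}X′, M_A X) = M_{A′}·𝔇(X′, X) + 𝔇(M_{A′}, M_A)·X`, `𝔇(M_{a′}T′, M_aT) = M_{a′}·𝔇(T′, T) + 𝔇(M_{a′}, M_a)·T`, only these letters appear: the partition's `c₁ = |∇^±h|`,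
`c₀ = |h∘e^{±1} − h|` (BOTH grids) and fits `o₁`, `o₀`; the cube's coarse entries `β, β₁` and two-grid defects `m₀, m₁`; the species' FINE coefficient rows `r_A` and the coefficient
FIT `Σ_k|A′(x′) − A(πx′)|_{ik} ≤ o_A` — `r_V = |J|·2·(r_A(c₁m₀ + o₁β + c₀m₁ + o₀β₁) + o_A(c₁β + c₀β₁))`.  §3 then identifies Bałaban's covariant Laplacian (3.50) in transport form
(FILE 28 `covLapM`) with FILE 46's Laplacian-type operator BY NAME: `Δ_R = lapOp η⁻¹ (liftEquiv ∘ τ) (−V(c_R, a_R))` — so FILE 46 §2–§4 apply to `Δ_R` verbatim, and §4 states the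
two per-cube rows of `Δ_R` (the (2.134) letter and its η-defect) with NO `W`-letter displayed.

* §1 `commOp_neg_comp`; ★ `hasMaj_idef_mmulOp_comp_add_loc` ∕ `hasMaj_idef_mmulOp_comp_sub_loc` — the three-factor Leibniz pieces `𝔇(M_{A′}(X₁′ ± X₂′), M_A(X₁ ± X₂)) ≤
  r_A·(D₁ + D₂) + o_A·(K₁ + K₂)` from fine rows `r_A`, coefficient fit `o_A`, coarse majorants `K_i` of `X_i` and defects `D_i` of `(X_i′, X_i)`;
* §2 ★★ `hasMaj_idef_commOp_speciesOpM_comp` — FILE 46's `hDW` row for `W = V`; ★ `hasMaj_idef_commOp_neg_speciesOpM_comp` (`W = −V`, the sign of (3.53));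
* §3 ★ `covLapM_one_eq_sum_lapDir` (`Δ_1 = Σ_μ ∇*_μ∇_μ` on the product carrier, `n = η⁻¹`), ★★ `covLapM_eq_lapOp` (`Δ_R = lapOp η⁻¹ (liftEquiv∘τ) (−V(tCoefC, tCoefA))`, every `η`);
* §4 (FLAT-ENTRIES EDITION of the per-cube rows of `Δ_R`; the COVARIANT-ENTRIES edition — cube entries `D^±_μ∘G` for n15-b's `covD`, no coefficient letter — is dag-n15-c FILE 52
  `…TwoSpacingGluingCovariant`) ★★ `hasMaj_commOp_covLapM_comp_flatEntries` — the (2.134) letter of `[Δ_R, M_h]∘G` from the cube's FLAT entries 0∕1 (`G`, `∇^±_μG`), the partition's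
  `c₀, c₁, c₂` and the transport coefficient rows `r_A`: `≤ 1_S1_S·|J|·(c₂β + 2c₁β₁ + 2r_A(c₁β + c₀β₁))·e^{−δd}`; ★★ `hasMaj_idef_commOp_covLapM_comp_flatEntries` — its η-defect
  `≤ 1_S1_S·|J|·(c₂m₀ + o₂β + 2(c₁m₁ + o₁β₁) + 2(r_A(c₁m₀ + o₁β + c₀m₁ + o₀β₁) + o_A(c₁β + c₀β₁)))·e^{−δd}`.

HONEST FRAMING ∕ LIMITS.  Lattice Leibniz bookkeeping in dag-n15-c's row currency (no estimate); every letter is DISPLAYED ((3.35)–(3.37) p. 396, (3.50)–(3.53) p. 400, (2.133)–(2.134)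
p. 247, Thm 3.14 pp. 426–427 difference template = SHAPES ∕ MECHANISM); the operator Bałaban inverts in NE2 is `D R D* + Δ_U + Q*aQ` ((3.26) p. 395) — §3–§4 treat the `Δ_U` summand
only (`Q*aQ`: dag-n15-c FILE 51; `DRD*`: open), and §4 reads the background through the (3.37)-shaped rows `r_A` of `a_R` against FLAT entries (cruder than the covariant-entries edition);
the ADJOINT rows `G∘[V, M_h]` of FILE 49's arrangement are NOT here; nothing of [B6]∕[B9] asserted.  NE2⁺ NOT PRINTED, NOT proved; N15
NOT discharged; counts of record UNMOVED (typed 28∕28 · discharged 5∕27); one finite 𝕋⁴ at fixed ε — NOT infinite volume, NOT OS on ℝ⁴, NOT a mass gap, NOT Clay; R4 closes the conditional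
finite-𝕋⁴ rung `BalabanLadder.UV` only.  Restate-immune (no Theses import).
-/

set_option autoImplicit false

noncomputable section
open scoped BigOperators
open Finset

namespace Summit.QuantumFields.YangMills.BalabanUVNodes.N15.CurvedSpecies

open Literature.MathematicalPhysics.QuantumFieldTheory.Balaban1983to89
open Literature.MathematicalPhysics.QuantumFieldTheory.Balaban1983to89.B11SectG (BlockNorm HasMaj)
open Literature.MathematicalPhysics.QuantumFieldTheory.Balaban1983to89.T4EtaRateDefect (idef idef_apply idef_comp idef_add idef_sub)
open Literature.MathematicalPhysics.QuantumFieldTheory.Balaban1983to89.T4EtaRateCoeffDefect (pull pull_apply diagK diagK_nonneg)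
open Literature.MathematicalPhysics.QuantumFieldTheory.Balaban1983to89.B6Prop26Gluing (mulOp mulOp_apply ind ind_nonneg)
open Summit.QuantumFields.YangMills.BalabanUVNodes.N15.MatrixSpecies (mmulOp mmulOp_apply liftMap liftBlk liftEquiv liftEquiv_apply liftEquiv_symm_apply hasMaj_mmulOp hasMaj_idef_mmulOp)
open Summit.QuantumFields.YangMills.BalabanUVNodes.N15.BackgroundLayer (fgrad fgradAdj bgrad fgrad_apply fgradAdj_apply bgrad_apply speciesOpM covLapM tCoefA tCoefC covLapM_one_eq
  covLapM_eq_one_sub_speciesOpM)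
open Summit.QuantumFields.YangMills.BalabanUVNodes.N15.Gluing (commOp lapDir lapOp hasMaj_diag_comp hasMaj_fsum hasMaj_mulOp_comp_loc hasMaj_idef_mulOp_comp_loc hasMaj_commOp_lapOp_comp
  hasMaj_idef_commOp_lapOp_comp idef_fsum idef_neg)

/-! ## §1 The three-factor Leibniz pieces `𝔇(M_{A′}X′, M_A X)` on the product carrier -/

section Pieces

variable {Y : Type}

/-- `[−Δ, M_a]∘G = −([Δ, M_a]∘G)`. [folklore] -/
theorem commOp_neg_comp (Δ G : (Y → ℝ) →ₗ[ℝ] (Y → ℝ)) (a : Y → ℝ) : commOp (-Δ) a ∘ₗ G = -(commOp Δ a ∘ₗ G) := by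
  simp only [commOp, LinearMap.neg_comp, LinearMap.comp_neg, LinearMap.sub_comp]
  abel

variable {X X' ι : Type} [Fintype X] [Fintype X'] [Fintype ι] {g : B6.Geometry} (blk : X → g.Site) (π : X' → X)

/-- ★ THREE-FACTOR LEIBNIZ, SUM: `𝔇(M_{A′}(X₁′ + X₂′), M_A(X₁ + X₂)) = M_{A′}·(𝔇(X₁′,X₁) + 𝔇(X₂′,X₂)) + 𝔇(M_{A′}, M_A)·(X₁ + X₂) ≤ r_A·(D₁ + D₂) + o_A·(K₁ + K₂)` from the FINE coefficient rows
`Σ_k|A′(x′)_{ik}| ≤ r_A` (n15-b `hasMaj_mmulOp`), the coefficient FIT `Σ_k|A′(x′)_{ik} − A(πx′)_{ik}| ≤ o_A` (n15-b `hasMaj_idef_mmulOp`), coarse majorants `X_i ≤ K_i` and defects `𝔇(X_i′, X_i) ≤ D_i`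
(blocks `liftBlk blk ι`, fine blocks `liftBlk blk ι ∘ liftMap π ι`, transports `pull (liftMap π ι)` — dag-n15-c's instantiation shape). [cite: Balaban1985BackgroundPropagators, Thm 3.14 pp.426–427 (difference template: shape)] -/
theorem hasMaj_idef_mmulOp_comp_add_loc {A' : X' → Matrix ι ι ℝ} {A : X → Matrix ι ι ℝ} {X₁' X₂' : (X' × ι → ℝ) →ₗ[ℝ] (X' × ι → ℝ)}
    {X₁ X₂ : (X × ι → ℝ) →ₗ[ℝ] (X × ι → ℝ)} {K₁ K₂ D₁ D₂ : g.Site → g.Site → ℝ} {rA oA : ℝ} (hrA : 0 ≤ rA) (hoA : 0 ≤ oA)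
    (hA' : ∀ x' i, ∑ k, |A' x' i k| ≤ rA) (hfA : ∀ x' i, ∑ k, |A' x' i k - A (π x') i k| ≤ oA)
    (h₁ : HasMaj (BlockNorm.ofBlocks g (liftBlk blk ι)) (BlockNorm.ofBlocks g (liftBlk blk ι)) X₁ K₁)
    (h₂ : HasMaj (BlockNorm.ofBlocks g (liftBlk blk ι)) (BlockNorm.ofBlocks g (liftBlk blk ι)) X₂ K₂)
    (hd₁ : HasMaj (BlockNorm.ofBlocks g (liftBlk blk ι)) (BlockNorm.ofBlocks g (liftBlk blk ι ∘ liftMap π ι)) (idef (pull (liftMap π ι)) (pull (liftMap π ι)) X₁' X₁) D₁)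
    (hd₂ : HasMaj (BlockNorm.ofBlocks g (liftBlk blk ι)) (BlockNorm.ofBlocks g (liftBlk blk ι ∘ liftMap π ι)) (idef (pull (liftMap π ι)) (pull (liftMap π ι)) X₂' X₂) D₂) :
    HasMaj (BlockNorm.ofBlocks g (liftBlk blk ι)) (BlockNorm.ofBlocks g (liftBlk blk ι ∘ liftMap π ι))
      (idef (pull (liftMap π ι)) (pull (liftMap π ι)) (mmulOp A' ∘ₗ (X₁' + X₂')) (mmulOp A ∘ₗ (X₁ + X₂)))
      (fun y y' => rA * (D₁ y y' + D₂ y y') + oA * (K₁ y y' + K₂ y y')) := by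
  have hMA' := hasMaj_mmulOp (g := g) (blk ∘ π) (C := A') (m := fun _ => rA) (fun _ => hrA) hA'
  have hDA := hasMaj_idef_mmulOp (g := g) blk π (C' := A') (C := A) (o := fun _ => oA) (fun _ => hoA) hfA
  rw [idef_comp (pull (liftMap π ι)) (pull (liftMap π ι)) (pull (liftMap π ι)), idef_add]
  exact (hasMaj_diag_comp (liftBlk (blk ∘ π) ι) (fun _ => hrA) hMA' (hd₁.add hd₂)).add (hasMaj_diag_comp (liftBlk blk ι) (fun _ => hoA) hDA (h₁.add h₂))

/-- ★ THREE-FACTOR LEIBNIZ, DIFFERENCE: `𝔇(M_{A′}(X₁′ − X₂′), M_A(X₁ − X₂)) ≤ r_A·(D₁ + D₂) + o_A·(K₁ + K₂)` (same letters). [cite: Balaban1985BackgroundPropagators, Thm 3.14 pp.426–427 (difference template: shape)] -/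
theorem hasMaj_idef_mmulOp_comp_sub_loc {A' : X' → Matrix ι ι ℝ} {A : X → Matrix ι ι ℝ} {X₁' X₂' : (X' × ι → ℝ) →ₗ[ℝ] (X' × ι → ℝ)}
    {X₁ X₂ : (X × ι → ℝ) →ₗ[ℝ] (X × ι → ℝ)} {K₁ K₂ D₁ D₂ : g.Site → g.Site → ℝ} {rA oA : ℝ} (hrA : 0 ≤ rA) (hoA : 0 ≤ oA)
    (hA' : ∀ x' i, ∑ k, |A' x' i k| ≤ rA) (hfA : ∀ x' i, ∑ k, |A' x' i k - A (π x') i k| ≤ oA)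
    (h₁ : HasMaj (BlockNorm.ofBlocks g (liftBlk blk ι)) (BlockNorm.ofBlocks g (liftBlk blk ι)) X₁ K₁)
    (h₂ : HasMaj (BlockNorm.ofBlocks g (liftBlk blk ι)) (BlockNorm.ofBlocks g (liftBlk blk ι)) X₂ K₂)
    (hd₁ : HasMaj (BlockNorm.ofBlocks g (liftBlk blk ι)) (BlockNorm.ofBlocks g (liftBlk blk ι ∘ liftMap π ι)) (idef (pull (liftMap π ι)) (pull (liftMap π ι)) X₁' X₁) D₁)
    (hd₂ : HasMaj (BlockNorm.ofBlocks g (liftBlk blk ι)) (BlockNorm.ofBlocks g (liftBlk blk ι ∘ liftMap π ι)) (idef (pull (liftMap π ι)) (pull (liftMap π ι)) X₂' X₂) D₂) :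
    HasMaj (BlockNorm.ofBlocks g (liftBlk blk ι)) (BlockNorm.ofBlocks g (liftBlk blk ι ∘ liftMap π ι))
      (idef (pull (liftMap π ι)) (pull (liftMap π ι)) (mmulOp A' ∘ₗ (X₁' - X₂')) (mmulOp A ∘ₗ (X₁ - X₂)))
      (fun y y' => rA * (D₁ y y' + D₂ y y') + oA * (K₁ y y' + K₂ y y')) := by
  have hMA' := hasMaj_mmulOp (g := g) (blk ∘ π) (C := A') (m := fun _ => rA) (fun _ => hrA) hA'
  have hDA := hasMaj_idef_mmulOp (g := g) blk π (C' := A') (C := A) (o := fun _ => oA) (fun _ => hoA) hfA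
  rw [idef_comp (pull (liftMap π ι)) (pull (liftMap π ι)) (pull (liftMap π ι)), idef_sub]
  exact (hasMaj_diag_comp (liftBlk (blk ∘ π) ι) (fun _ => hrA) hMA' (hd₁.sub hd₂)).add (hasMaj_diag_comp (liftBlk blk ι) (fun _ => hoA) hDA (h₁.sub h₂))

end Pieces

/-! ## §2 The η-defect row of the species commutator from the cube's entry-0∕1 defects -/

section Row

variable {X X' ι J : Type} [Fintype X] [Fintype X'] [Fintype ι] [Fintype J] {g : B6.Geometry} (blk : X → g.Site) (π : X' → X)
variable (τ : J → X ≃ X) (τ' : J → X' ≃ X') (n n' : ℝ) (C : X → Matrix ι ι ℝ) (C' : X' → Matrix ι ι ℝ) (A : J ⊕ J → X → Matrix ι ι ℝ) (A' : J ⊕ J → X' → Matrix ι ι ℝ)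
  (hX : X → ℝ) (hX' : X' → ℝ) (G : (X × ι → ℝ) →ₗ[ℝ] (X × ι → ℝ)) (G' : (X' × ι → ℝ) →ₗ[ℝ] (X' × ι → ℝ))

/-- ★★ **dag-n15-c FILE 46's `hDW` ROW FOR `W = V`, THE BACKGROUND SPECIES — the η-defect of the commutator piece from cube entry-0∕1 defects.**  Data at two spacings (coarse
unprimed on `X × ι`, fine primed on `X′ × ι`, `π : X′ → X` lifted by `liftMap π ι`): the partition functions `h = h_X∘pr₁`, `h′ = h_{X′}∘pr₁` with `|∇^±_μh|, |∇′^±_μh′| ≤ c₁`,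
`|h∘e_μ^{±1} − h|, |h′∘e′_μ^{±1} − h′| ≤ c₀` and the fits `|∇′^±h′ − (∇^±h)∘π| ≤ o₁`, `|(h′∘e′^{±1} − h′) − (h∘e^{±1} − h)∘π| ≤ o₀`; the coarse cube's entries `G ≤ 1_S1_S·βe^{−δd}`,
`∇^±_μG ≤ 1_S1_S·β₁e^{−δd}` and the two-grid defects `𝔇(G′, G) ≤ 1_S1_S·m₀e^{−δd}`, `𝔇(∇′^±G′, ∇^±G) ≤ 1_S1_S·m₁e^{−δd}`; the FINE species' coefficient rows `Σ_k|A′^±_μ(x′)_{ik}| ≤ r_A` and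
the coefficient fit `Σ_k|A′^±_μ(x′)_{ik} − A^±_μ(πx′)_{ik}| ≤ o_A`.  Then
`𝔇([V′, M_{h′}]G′, [V, M_h]G) ≤ 1_S(y)1_S(y′)·|J|·2·(r_A(c₁m₀ + o₁β + c₀m₁ + o₀β₁) + o_A(c₁β + c₀β₁))·e^{−δd}`.
[cite: Balaban1984PropagatorsII, (2.133)–(2.134) p.247 (shapes); Balaban1985BackgroundPropagators, (3.37) p.396, (3.52) p.400 (shapes), Thm 3.14 pp.426–427 (difference template)] -/
theorem hasMaj_idef_commOp_speciesOpM_comp {S : Set g.Site} {β β₁ c₁ c₀ o₁ o₀ m₀ m₁ rA oA δ : ℝ} (hc₁ : 0 ≤ c₁) (hc₀ : 0 ≤ c₀) (ho₁ : 0 ≤ o₁) (ho₀ : 0 ≤ o₀)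
    (hrA : 0 ≤ rA) (hoA : 0 ≤ oA)
    -- coarse partition letters
    (hh1 : ∀ μ p, |fgrad n (liftEquiv (τ μ) ι) (fun p : X × ι => hX p.1) p| ≤ c₁) (hh1b : ∀ μ p, |bgrad n (liftEquiv (τ μ) ι) (fun p : X × ι => hX p.1) p| ≤ c₁)
    (hh0 : ∀ μ (p : X × ι), |hX ((liftEquiv (τ μ) ι) p).1 - hX p.1| ≤ c₀) (hh0b : ∀ μ (p : X × ι), |hX p.1 - hX ((liftEquiv (τ μ) ι).symm p).1| ≤ c₀)
    -- fine partition letters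
    (hh1' : ∀ μ p', |fgrad n' (liftEquiv (τ' μ) ι) (fun p' : X' × ι => hX' p'.1) p'| ≤ c₁)
    (hh1b' : ∀ μ p', |bgrad n' (liftEquiv (τ' μ) ι) (fun p' : X' × ι => hX' p'.1) p'| ≤ c₁)
    (hh0' : ∀ μ (p' : X' × ι), |hX' ((liftEquiv (τ' μ) ι) p').1 - hX' p'.1| ≤ c₀)
    (hh0b' : ∀ μ (p' : X' × ι), |hX' p'.1 - hX' ((liftEquiv (τ' μ) ι).symm p').1| ≤ c₀)
    -- partition fits
    (hf1 : ∀ μ p', |fgrad n' (liftEquiv (τ' μ) ι) (fun p' : X' × ι => hX' p'.1) p' - fgrad n (liftEquiv (τ μ) ι) (fun p : X × ι => hX p.1) (liftMap π ι p')| ≤ o₁)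
    (hf1b : ∀ μ p', |bgrad n' (liftEquiv (τ' μ) ι) (fun p' : X' × ι => hX' p'.1) p' - bgrad n (liftEquiv (τ μ) ι) (fun p : X × ι => hX p.1) (liftMap π ι p')| ≤ o₁)
    (hf0 : ∀ μ (p' : X' × ι), |(hX' ((liftEquiv (τ' μ) ι) p').1 - hX' p'.1) - (hX ((liftEquiv (τ μ) ι) (liftMap π ι p')).1 - hX (liftMap π ι p').1)| ≤ o₀)
    (hf0b : ∀ μ (p' : X' × ι), |(hX' p'.1 - hX' ((liftEquiv (τ' μ) ι).symm p').1) - (hX (liftMap π ι p').1 - hX ((liftEquiv (τ μ) ι).symm (liftMap π ι p')).1)| ≤ o₀)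
    -- fine coefficient rows and the coefficient fit
    (hA' : ∀ j x' i, ∑ k, |A' j x' i k| ≤ rA) (hfA : ∀ j x' i, ∑ k, |A' j x' i k - A j (π x') i k| ≤ oA)
    -- coarse cube entries 0∕1 and the two-grid defects
    (hG : HasMaj (BlockNorm.ofBlocks g (liftBlk blk ι)) (BlockNorm.ofBlocks g (liftBlk blk ι)) G (fun y y' => ind S y * ind S y' * (β * Real.exp (-(δ * g.dist y y')))))
    (hD : ∀ μ, HasMaj (BlockNorm.ofBlocks g (liftBlk blk ι)) (BlockNorm.ofBlocks g (liftBlk blk ι)) (fgrad n (liftEquiv (τ μ) ι) ∘ₗ G)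
      (fun y y' => ind S y * ind S y' * (β₁ * Real.exp (-(δ * g.dist y y')))))
    (hDb : ∀ μ, HasMaj (BlockNorm.ofBlocks g (liftBlk blk ι)) (BlockNorm.ofBlocks g (liftBlk blk ι)) (bgrad n (liftEquiv (τ μ) ι) ∘ₗ G)
      (fun y y' => ind S y * ind S y' * (β₁ * Real.exp (-(δ * g.dist y y')))))
    (hDG : HasMaj (BlockNorm.ofBlocks g (liftBlk blk ι)) (BlockNorm.ofBlocks g (liftBlk blk ι ∘ liftMap π ι)) (idef (pull (liftMap π ι)) (pull (liftMap π ι)) G' G)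
      (fun y y' => ind S y * ind S y' * (m₀ * Real.exp (-(δ * g.dist y y')))))
    (hDD : ∀ μ, HasMaj (BlockNorm.ofBlocks g (liftBlk blk ι)) (BlockNorm.ofBlocks g (liftBlk blk ι ∘ liftMap π ι))
      (idef (pull (liftMap π ι)) (pull (liftMap π ι)) (fgrad n' (liftEquiv (τ' μ) ι) ∘ₗ G') (fgrad n (liftEquiv (τ μ) ι) ∘ₗ G))
      (fun y y' => ind S y * ind S y' * (m₁ * Real.exp (-(δ * g.dist y y')))))
    (hDDb : ∀ μ, HasMaj (BlockNorm.ofBlocks g (liftBlk blk ι)) (BlockNorm.ofBlocks g (liftBlk blk ι ∘ liftMap π ι))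
      (idef (pull (liftMap π ι)) (pull (liftMap π ι)) (bgrad n' (liftEquiv (τ' μ) ι) ∘ₗ G') (bgrad n (liftEquiv (τ μ) ι) ∘ₗ G))
      (fun y y' => ind S y * ind S y' * (m₁ * Real.exp (-(δ * g.dist y y'))))) :
    HasMaj (BlockNorm.ofBlocks g (liftBlk blk ι)) (BlockNorm.ofBlocks g (liftBlk blk ι ∘ liftMap π ι))
      (idef (pull (liftMap π ι)) (pull (liftMap π ι)) (commOp (speciesOpM τ' n' C' A') (fun p' : X' × ι => hX' p'.1) ∘ₗ G')
        (commOp (speciesOpM τ n C A) (fun p : X × ι => hX p.1) ∘ₗ G))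
      (fun y y' => ind S y * ind S y' * ((Fintype.card J * (2 * (rA * (c₁ * m₀ + o₁ * β + c₀ * m₁ + o₀ * β₁) + oA * (c₁ * β + c₀ * β₁)))) * Real.exp (-(δ * g.dist y y')))) := by
  -- per direction μ: forward piece `+`, backward piece `−`, each `≤ r_A(c₁m₀ + o₁β + c₀m₁ + o₀β₁) + o_A(c₁β + c₀β₁)`
  have hterm : ∀ μ, HasMaj (BlockNorm.ofBlocks g (liftBlk blk ι)) (BlockNorm.ofBlocks g (liftBlk blk ι ∘ liftMap π ι))
      (idef (pull (liftMap π ι)) (pull (liftMap π ι))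
        (mmulOp (A' (Sum.inl μ)) ∘ₗ (mulOp (fgrad n' (liftEquiv (τ' μ) ι) (fun p' : X' × ι => hX' p'.1)) ∘ₗ G' +
            mulOp (fun p' : X' × ι => hX' ((liftEquiv (τ' μ) ι) p').1 - hX' p'.1) ∘ₗ (fgrad n' (liftEquiv (τ' μ) ι) ∘ₗ G')) +
          mmulOp (A' (Sum.inr μ)) ∘ₗ (mulOp (bgrad n' (liftEquiv (τ' μ) ι) (fun p' : X' × ι => hX' p'.1)) ∘ₗ G' -
            mulOp (fun p' : X' × ι => hX' p'.1 - hX' ((liftEquiv (τ' μ) ι).symm p').1) ∘ₗ (bgrad n' (liftEquiv (τ' μ) ι) ∘ₗ G')))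
        (mmulOp (A (Sum.inl μ)) ∘ₗ (mulOp (fgrad n (liftEquiv (τ μ) ι) (fun p : X × ι => hX p.1)) ∘ₗ G +
            mulOp (fun p : X × ι => hX ((liftEquiv (τ μ) ι) p).1 - hX p.1) ∘ₗ (fgrad n (liftEquiv (τ μ) ι) ∘ₗ G)) +
          mmulOp (A (Sum.inr μ)) ∘ₗ (mulOp (bgrad n (liftEquiv (τ μ) ι) (fun p : X × ι => hX p.1)) ∘ₗ G -
            mulOp (fun p : X × ι => hX p.1 - hX ((liftEquiv (τ μ) ι).symm p).1) ∘ₗ (bgrad n (liftEquiv (τ μ) ι) ∘ₗ G))))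
      (fun y y' => ind S y * ind S y' * ((2 * (rA * (c₁ * m₀ + o₁ * β + c₀ * m₁ + o₀ * β₁) + oA * (c₁ * β + c₀ * β₁))) * Real.exp (-(δ * g.dist y y')))) := fun μ => by
    -- coarse majorants of the four scalar pieces
    have f1 := hasMaj_mulOp_comp_loc (liftBlk blk ι) hc₁ (hh1 μ) hG
    have f2 := hasMaj_mulOp_comp_loc (liftBlk blk ι) hc₀ (hh0 μ) (hD μ)
    have b1 := hasMaj_mulOp_comp_loc (liftBlk blk ι) hc₁ (hh1b μ) hG
    have b2 := hasMaj_mulOp_comp_loc (liftBlk blk ι) hc₀ (hh0b μ) (hDb μ)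
    -- their η-defects (FILE 46's two-factor Leibniz)
    have f1d := hasMaj_idef_mulOp_comp_loc (liftBlk blk ι) (liftMap π ι) hc₁ ho₁ (hh1' μ) (hf1 μ) hG hDG
    have f2d := hasMaj_idef_mulOp_comp_loc (liftBlk blk ι) (liftMap π ι) (a := fun p : X × ι => hX ((liftEquiv (τ μ) ι) p).1 - hX p.1) hc₀ ho₀ (hh0' μ) (hf0 μ)
      (hD μ) (hDD μ)
    have b1d := hasMaj_idef_mulOp_comp_loc (liftBlk blk ι) (liftMap π ι) hc₁ ho₁ (hh1b' μ) (hf1b μ) hG hDG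
    have b2d := hasMaj_idef_mulOp_comp_loc (liftBlk blk ι) (liftMap π ι) (a := fun p : X × ι => hX p.1 - hX ((liftEquiv (τ μ) ι).symm p).1) hc₀ ho₀ (hh0b' μ) (hf0b μ)
      (hDb μ) (hDDb μ)
    -- the matrix coefficients (three-factor Leibniz)
    have tf := hasMaj_idef_mmulOp_comp_add_loc blk π hrA hoA (hA' (Sum.inl μ)) (hfA (Sum.inl μ)) f1 f2 f1d f2d
    have tb := hasMaj_idef_mmulOp_comp_sub_loc blk π hrA hoA (hA' (Sum.inr μ)) (hfA (Sum.inr μ)) b1 b2 b1d b2d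
    rw [idef_add]
    refine (tf.add tb).mono fun y y' => le_of_eq ?_
    ring
  rw [commOp_speciesOpM_comp, commOp_speciesOpM_comp, idef_fsum]
  refine (hasMaj_fsum (b₁ := BlockNorm.ofBlocks g (liftBlk blk ι)) (b₃ := BlockNorm.ofBlocks g (liftBlk blk ι ∘ liftMap π ι)) Finset.univ _ _
    fun μ _ => hterm μ).mono fun y y' => le_of_eq ?_
  simp only [Finset.sum_const, Finset.card_univ, nsmul_eq_mul]
  ring

/-- ★ THE `hDW` ROW FOR `W = −V` (the sign of (3.53): `Δ_U = Δ_1 − V`): `𝔇([−V′, M_{h′}]G′, [−V, M_h]G)` has the same letter. [cite: Balaban1985BackgroundPropagators, (3.53) p.400 (shape)] -/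
theorem hasMaj_idef_commOp_neg_speciesOpM_comp {S : Set g.Site} {β β₁ c₁ c₀ o₁ o₀ m₀ m₁ rA oA δ : ℝ} (hc₁ : 0 ≤ c₁) (hc₀ : 0 ≤ c₀) (ho₁ : 0 ≤ o₁) (ho₀ : 0 ≤ o₀)
    (hrA : 0 ≤ rA) (hoA : 0 ≤ oA)
    (hh1 : ∀ μ p, |fgrad n (liftEquiv (τ μ) ι) (fun p : X × ι => hX p.1) p| ≤ c₁) (hh1b : ∀ μ p, |bgrad n (liftEquiv (τ μ) ι) (fun p : X × ι => hX p.1) p| ≤ c₁)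
    (hh0 : ∀ μ (p : X × ι), |hX ((liftEquiv (τ μ) ι) p).1 - hX p.1| ≤ c₀) (hh0b : ∀ μ (p : X × ι), |hX p.1 - hX ((liftEquiv (τ μ) ι).symm p).1| ≤ c₀)
    (hh1' : ∀ μ p', |fgrad n' (liftEquiv (τ' μ) ι) (fun p' : X' × ι => hX' p'.1) p'| ≤ c₁)
    (hh1b' : ∀ μ p', |bgrad n' (liftEquiv (τ' μ) ι) (fun p' : X' × ι => hX' p'.1) p'| ≤ c₁)
    (hh0' : ∀ μ (p' : X' × ι), |hX' ((liftEquiv (τ' μ) ι) p').1 - hX' p'.1| ≤ c₀)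
    (hh0b' : ∀ μ (p' : X' × ι), |hX' p'.1 - hX' ((liftEquiv (τ' μ) ι).symm p').1| ≤ c₀)
    (hf1 : ∀ μ p', |fgrad n' (liftEquiv (τ' μ) ι) (fun p' : X' × ι => hX' p'.1) p' - fgrad n (liftEquiv (τ μ) ι) (fun p : X × ι => hX p.1) (liftMap π ι p')| ≤ o₁)
    (hf1b : ∀ μ p', |bgrad n' (liftEquiv (τ' μ) ι) (fun p' : X' × ι => hX' p'.1) p' - bgrad n (liftEquiv (τ μ) ι) (fun p : X × ι => hX p.1) (liftMap π ι p')| ≤ o₁)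
    (hf0 : ∀ μ (p' : X' × ι), |(hX' ((liftEquiv (τ' μ) ι) p').1 - hX' p'.1) - (hX ((liftEquiv (τ μ) ι) (liftMap π ι p')).1 - hX (liftMap π ι p').1)| ≤ o₀)
    (hf0b : ∀ μ (p' : X' × ι), |(hX' p'.1 - hX' ((liftEquiv (τ' μ) ι).symm p').1) - (hX (liftMap π ι p').1 - hX ((liftEquiv (τ μ) ι).symm (liftMap π ι p')).1)| ≤ o₀)
    (hA' : ∀ j x' i, ∑ k, |A' j x' i k| ≤ rA) (hfA : ∀ j x' i, ∑ k, |A' j x' i k - A j (π x') i k| ≤ oA)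
    (hG : HasMaj (BlockNorm.ofBlocks g (liftBlk blk ι)) (BlockNorm.ofBlocks g (liftBlk blk ι)) G (fun y y' => ind S y * ind S y' * (β * Real.exp (-(δ * g.dist y y')))))
    (hD : ∀ μ, HasMaj (BlockNorm.ofBlocks g (liftBlk blk ι)) (BlockNorm.ofBlocks g (liftBlk blk ι)) (fgrad n (liftEquiv (τ μ) ι) ∘ₗ G)
      (fun y y' => ind S y * ind S y' * (β₁ * Real.exp (-(δ * g.dist y y')))))
    (hDb : ∀ μ, HasMaj (BlockNorm.ofBlocks g (liftBlk blk ι)) (BlockNorm.ofBlocks g (liftBlk blk ι)) (bgrad n (liftEquiv (τ μ) ι) ∘ₗ G)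
      (fun y y' => ind S y * ind S y' * (β₁ * Real.exp (-(δ * g.dist y y')))))
    (hDG : HasMaj (BlockNorm.ofBlocks g (liftBlk blk ι)) (BlockNorm.ofBlocks g (liftBlk blk ι ∘ liftMap π ι)) (idef (pull (liftMap π ι)) (pull (liftMap π ι)) G' G)
      (fun y y' => ind S y * ind S y' * (m₀ * Real.exp (-(δ * g.dist y y')))))
    (hDD : ∀ μ, HasMaj (BlockNorm.ofBlocks g (liftBlk blk ι)) (BlockNorm.ofBlocks g (liftBlk blk ι ∘ liftMap π ι))
      (idef (pull (liftMap π ι)) (pull (liftMap π ι)) (fgrad n' (liftEquiv (τ' μ) ι) ∘ₗ G') (fgrad n (liftEquiv (τ μ) ι) ∘ₗ G))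
      (fun y y' => ind S y * ind S y' * (m₁ * Real.exp (-(δ * g.dist y y')))))
    (hDDb : ∀ μ, HasMaj (BlockNorm.ofBlocks g (liftBlk blk ι)) (BlockNorm.ofBlocks g (liftBlk blk ι ∘ liftMap π ι))
      (idef (pull (liftMap π ι)) (pull (liftMap π ι)) (bgrad n' (liftEquiv (τ' μ) ι) ∘ₗ G') (bgrad n (liftEquiv (τ μ) ι) ∘ₗ G))
      (fun y y' => ind S y * ind S y' * (m₁ * Real.exp (-(δ * g.dist y y'))))) :
    HasMaj (BlockNorm.ofBlocks g (liftBlk blk ι)) (BlockNorm.ofBlocks g (liftBlk blk ι ∘ liftMap π ι))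
      (idef (pull (liftMap π ι)) (pull (liftMap π ι)) (commOp (-speciesOpM τ' n' C' A') (fun p' : X' × ι => hX' p'.1) ∘ₗ G')
        (commOp (-speciesOpM τ n C A) (fun p : X × ι => hX p.1) ∘ₗ G))
      (fun y y' => ind S y * ind S y' * ((Fintype.card J * (2 * (rA * (c₁ * m₀ + o₁ * β + c₀ * m₁ + o₀ * β₁) + oA * (c₁ * β + c₀ * β₁)))) * Real.exp (-(δ * g.dist y y')))) := by
  rw [commOp_neg_comp, commOp_neg_comp, idef_neg]
  exact (hasMaj_idef_commOp_speciesOpM_comp blk π τ τ' n n' C C' A A' hX hX' G G' hc₁ hc₀ ho₁ ho₀ hrA hoA hh1 hh1b hh0 hh0b hh1' hh1b' hh0' hh0b' hf1 hf1b hf0 hf0b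
    hA' hfA hG hD hDb hDG hDD hDDb).neg

end Row

/-! ## §3 Bałaban's covariant Laplacian (3.50) IS a Laplacian-type operator of the gluing: `Δ_R = lapOp η⁻¹ (liftEquiv∘τ) (−V(c_R, a_R))` -/

section Bridge

variable {X J ι : Type} [Fintype J] [Fintype ι] [DecidableEq ι] (τ : J → X ≃ X)

/-- ★ THE FLAT LAPLACIAN ON THE PRODUCT CARRIER IS THE SUM OF THE DIRECTIONAL `∇*∇`: `Δ_1 = η⁻¹Σ_μ(∇⁻_μ − ∇⁺_μ) = Σ_μ ∇*_μ∇_μ` at `n = η⁻¹` (FILE 28 `covLapM_one_eq` + FILE 46 `lapDir`).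
[cite: Balaban1985BackgroundPropagators, (3.50) p.400 (at U ≡ 1); Balaban1984PropagatorsI, (1.3) p.18 (lattice derivatives: shape)] -/
theorem covLapM_one_eq_sum_lapDir (η : ℝ) :
    covLapM τ η (fun (_ : J ⊕ J) (_ : X) => (1 : Matrix ι ι ℝ)) = ∑ μ, lapDir η⁻¹ (liftEquiv (τ μ) ι) := by
  rw [covLapM_one_eq, Finset.smul_sum]
  refine Finset.sum_congr rfl fun μ _ => LinearMap.ext fun f => funext fun p => ?_
  simp only [lapDir, LinearMap.smul_apply, LinearMap.sub_apply, LinearMap.comp_apply, Pi.smul_apply, Pi.sub_apply, smul_eq_mul, fgrad_apply, bgrad_apply, fgradAdj_apply,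
    Equiv.apply_symm_apply, mul_sub]

/-- ★★ **BAŁABAN's COVARIANT LAPLACIAN (3.50) AS A LAPLACIAN-TYPE OPERATOR OF THE GLUING, BY NAME**: for arbitrary bond transports `R`,
`Δ_R = lapOp η⁻¹ (μ ↦ liftEquiv τ_μ ι) (−V(c_R, a_R))` with FILE 28's exact coefficients `a_R = tCoefA η R`, `c_R = tCoefC η R` (every `η`; (3.53) `Δ_R = Δ_1 − V` + §3's `Δ_1 = Σ∇*∇`) — so dag-n15-c
FILE 46's `hasMaj_commOp_lapOp_comp` ∕ `hasMaj_idef_commOp_lapOp_comp` ∕ `hasMaj_idef_glued_of_cubeEntries` apply to `Δ_R` verbatim with `W := −V(c_R, a_R)`.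
[cite: Balaban1985BackgroundPropagators, (3.50)–(3.53) p.400; Balaban1984PropagatorsII, (2.91)–(2.92) p.239 (the operator glued: shape)] -/
theorem covLapM_eq_lapOp (η : ℝ) (R : J ⊕ J → X → Matrix ι ι ℝ) :
    covLapM τ η R = lapOp η⁻¹ (fun μ => liftEquiv (τ μ) ι) (-speciesOpM τ η⁻¹ (tCoefC η R) (tCoefA η R)) := by
  rw [covLapM_eq_one_sub_speciesOpM, covLapM_one_eq_sum_lapDir, lapOp, sub_eq_add_neg]

end Bridge

/-! ## §4 The two per-cube rows of `Δ_R` for the gluing, FLAT-ENTRIES EDITION: the (2.134) letter and its η-defect from `G`, `∇^±G` and the transport rows -/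

section CovariantRows

variable {X X' ι J : Type} [Fintype X] [Fintype X'] [Fintype ι] [DecidableEq ι] [Fintype J] {g : B6.Geometry} (blk : X → g.Site) (π : X' → X)
variable (τ : J → X ≃ X) (τ' : J → X' ≃ X') (η η' : ℝ) (R : J ⊕ J → X → Matrix ι ι ℝ) (R' : J ⊕ J → X' → Matrix ι ι ℝ) (hX : X → ℝ) (hX' : X' → ℝ)
  (G : (X × ι → ℝ) →ₗ[ℝ] (X × ι → ℝ)) (G' : (X' × ι → ℝ) →ₗ[ℝ] (X' × ι → ℝ))

/-- ★★ **THE (2.134) LETTER OF `[Δ_R, M_h]∘G` FROM THE CUBE's FLAT ENTRIES 0∕1** (flat-entries edition; covariant-entries edition = dag-n15-c FILE 52), Bałaban's covariant Laplacian (3.50) at spacing `η` (`n = η⁻¹`): with `G ≤ 1_S1_S·βe^{−δd}`,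
`∇^±_μG ≤ 1_S1_S·β₁e^{−δd}` (`∇⁺_μ = fgrad η⁻¹ (liftEquiv τ_μ ι)`, `∇⁻_μ = bgrad …`), the partition's `|∇^±h| ≤ c₁`, `|∇*∇h| ≤ c₂`, `|h∘e^{±1} − h| ≤ c₀` and the transport coefficient rows
`Σ_k|a_R{}^±_μ(x)_{ik}| ≤ r_A` (`a_R = tCoefA η R`: `a⁺ = η⁻¹(R⁺ − 1)`, `a⁻ = η⁻¹(1 − R⁻)` — the (3.37)-shaped letter): `[Δ_R, M_h]∘G ≤ 1_S(y)1_S(y′)·|J|·(c₂β + 2c₁β₁ + 2r_A(c₁β + c₀β₁))·e^{−δd}`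
— FILE 46 `hasMaj_commOp_lapOp_comp` at §3's `Δ_R = lapOp … (−V)` with file 12's row as `hW`. [cite: Balaban1984PropagatorsII, (2.133)–(2.134) p.247 (shapes + mechanism); Balaban1985BackgroundPropagators, (3.37) p.396, (3.50)–(3.53) p.400 (shapes)] -/
theorem hasMaj_commOp_covLapM_comp_flatEntries {S : Set g.Site} {β β₁ c₁ c₂ c₀ rA δ : ℝ} (hc₁ : 0 ≤ c₁) (hc₂ : 0 ≤ c₂) (hc₀ : 0 ≤ c₀) (hrA : 0 ≤ rA)
    (hh1 : ∀ μ p, |fgrad η⁻¹ (liftEquiv (τ μ) ι) (fun p : X × ι => hX p.1) p| ≤ c₁) (hh1b : ∀ μ p, |bgrad η⁻¹ (liftEquiv (τ μ) ι) (fun p : X × ι => hX p.1) p| ≤ c₁)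
    (hh2 : ∀ μ p, |fgradAdj η⁻¹ (liftEquiv (τ μ) ι) (fgrad η⁻¹ (liftEquiv (τ μ) ι) (fun p : X × ι => hX p.1)) p| ≤ c₂)
    (hh0 : ∀ μ (p : X × ι), |hX ((liftEquiv (τ μ) ι) p).1 - hX p.1| ≤ c₀) (hh0b : ∀ μ (p : X × ι), |hX p.1 - hX ((liftEquiv (τ μ) ι).symm p).1| ≤ c₀)
    (hA : ∀ j x i, ∑ k, |tCoefA η R j x i k| ≤ rA)
    (hG : HasMaj (BlockNorm.ofBlocks g (liftBlk blk ι)) (BlockNorm.ofBlocks g (liftBlk blk ι)) G (fun y y' => ind S y * ind S y' * (β * Real.exp (-(δ * g.dist y y')))))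
    (hD : ∀ μ, HasMaj (BlockNorm.ofBlocks g (liftBlk blk ι)) (BlockNorm.ofBlocks g (liftBlk blk ι)) (fgrad η⁻¹ (liftEquiv (τ μ) ι) ∘ₗ G)
      (fun y y' => ind S y * ind S y' * (β₁ * Real.exp (-(δ * g.dist y y')))))
    (hDb : ∀ μ, HasMaj (BlockNorm.ofBlocks g (liftBlk blk ι)) (BlockNorm.ofBlocks g (liftBlk blk ι)) (bgrad η⁻¹ (liftEquiv (τ μ) ι) ∘ₗ G)
      (fun y y' => ind S y * ind S y' * (β₁ * Real.exp (-(δ * g.dist y y'))))) :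
    HasMaj (BlockNorm.ofBlocks g (liftBlk blk ι)) (BlockNorm.ofBlocks g (liftBlk blk ι)) (commOp (covLapM τ η R) (fun p : X × ι => hX p.1) ∘ₗ G)
      (fun y y' => ind S y * ind S y' * ((Fintype.card J * (c₂ * β + 2 * (c₁ * β₁) + 2 * rA * (c₁ * β + c₀ * β₁))) * Real.exp (-(δ * g.dist y y')))) := by
  have hW := hasMaj_commOp_neg_speciesOpM_comp blk τ η⁻¹ (tCoefC η R) (tCoefA η R) hX G hc₁ hc₀ hrA hh1 hh1b hh0 hh0b hA hG hD hDb
  rw [covLapM_eq_lapOp]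
  refine (hasMaj_commOp_lapOp_comp (liftBlk blk ι) (e := fun μ => liftEquiv (τ μ) ι) hc₁ hc₂ hh1 hh1b hh2 hG hD hDb hW).mono fun y y' => le_of_eq ?_
  ring

/-- ★★ **THE η-DEFECT OF `[Δ_R, M_h]∘G` FROM THE CUBE's FLAT ENTRY-0∕1 DEFECTS** (flat-entries edition), Bałaban's covariant Laplacian at two spacings `η` (coarse, transports `R`) and `η′` (fine, transports `R′`,
`π : X′ → X`): the partition letters `c₁, c₂, c₀` on both grids and fits `o₁, o₂, o₀`, the coarse cube's entries `β, β₁` and two-grid defects `m₀, m₁`, the FINE transport coefficient rows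
`Σ_k|a_{R′}{}^±(x′)_{ik}| ≤ r_A` and the coefficient fit `Σ_k|a_{R′}{}^±(x′)_{ik} − a_R{}^±(πx′)_{ik}| ≤ o_A` ⟹
`𝔇([Δ′_{R′}, M_{h′}]G′, [Δ_R, M_h]G) ≤ 1_S1_S·|J|·(c₂m₀ + o₂β + 2(c₁m₁ + o₁β₁) + 2(r_A(c₁m₀ + o₁β + c₀m₁ + o₀β₁) + o_A(c₁β + c₀β₁)))·e^{−δd}` — FILE 46 `hasMaj_idef_commOp_lapOp_comp` at §3's
identity on both grids with §2's row as `hDW`. [cite: Balaban1984PropagatorsII, (2.133)–(2.134) p.247 (shapes); Balaban1985BackgroundPropagators, (3.50)–(3.53) p.400 (shapes), Thm 3.14 pp.426–427 (difference template)] -/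
theorem hasMaj_idef_commOp_covLapM_comp_flatEntries {S : Set g.Site} {β β₁ c₁ c₂ c₀ o₁ o₂ o₀ m₀ m₁ rA oA δ : ℝ} (hc₁ : 0 ≤ c₁) (hc₂ : 0 ≤ c₂) (hc₀ : 0 ≤ c₀) (ho₁ : 0 ≤ o₁)
    (ho₂ : 0 ≤ o₂) (ho₀ : 0 ≤ o₀) (hrA : 0 ≤ rA) (hoA : 0 ≤ oA)
    (hh1 : ∀ μ p, |fgrad η⁻¹ (liftEquiv (τ μ) ι) (fun p : X × ι => hX p.1) p| ≤ c₁) (hh1b : ∀ μ p, |bgrad η⁻¹ (liftEquiv (τ μ) ι) (fun p : X × ι => hX p.1) p| ≤ c₁)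
    (hh0 : ∀ μ (p : X × ι), |hX ((liftEquiv (τ μ) ι) p).1 - hX p.1| ≤ c₀) (hh0b : ∀ μ (p : X × ι), |hX p.1 - hX ((liftEquiv (τ μ) ι).symm p).1| ≤ c₀)
    (hh1' : ∀ μ p', |fgrad η'⁻¹ (liftEquiv (τ' μ) ι) (fun p' : X' × ι => hX' p'.1) p'| ≤ c₁)
    (hh1b' : ∀ μ p', |bgrad η'⁻¹ (liftEquiv (τ' μ) ι) (fun p' : X' × ι => hX' p'.1) p'| ≤ c₁)
    (hh2' : ∀ μ p', |fgradAdj η'⁻¹ (liftEquiv (τ' μ) ι) (fgrad η'⁻¹ (liftEquiv (τ' μ) ι) (fun p' : X' × ι => hX' p'.1)) p'| ≤ c₂)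
    (hh0' : ∀ μ (p' : X' × ι), |hX' ((liftEquiv (τ' μ) ι) p').1 - hX' p'.1| ≤ c₀)
    (hh0b' : ∀ μ (p' : X' × ι), |hX' p'.1 - hX' ((liftEquiv (τ' μ) ι).symm p').1| ≤ c₀)
    (hf1 : ∀ μ p', |fgrad η'⁻¹ (liftEquiv (τ' μ) ι) (fun p' : X' × ι => hX' p'.1) p' - fgrad η⁻¹ (liftEquiv (τ μ) ι) (fun p : X × ι => hX p.1) (liftMap π ι p')| ≤ o₁)
    (hf1b : ∀ μ p', |bgrad η'⁻¹ (liftEquiv (τ' μ) ι) (fun p' : X' × ι => hX' p'.1) p' - bgrad η⁻¹ (liftEquiv (τ μ) ι) (fun p : X × ι => hX p.1) (liftMap π ι p')| ≤ o₁)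
    (hf2 : ∀ μ p', |fgradAdj η'⁻¹ (liftEquiv (τ' μ) ι) (fgrad η'⁻¹ (liftEquiv (τ' μ) ι) (fun p' : X' × ι => hX' p'.1)) p' -
      fgradAdj η⁻¹ (liftEquiv (τ μ) ι) (fgrad η⁻¹ (liftEquiv (τ μ) ι) (fun p : X × ι => hX p.1)) (liftMap π ι p')| ≤ o₂)
    (hf0 : ∀ μ (p' : X' × ι), |(hX' ((liftEquiv (τ' μ) ι) p').1 - hX' p'.1) - (hX ((liftEquiv (τ μ) ι) (liftMap π ι p')).1 - hX (liftMap π ι p').1)| ≤ o₀)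
    (hf0b : ∀ μ (p' : X' × ι), |(hX' p'.1 - hX' ((liftEquiv (τ' μ) ι).symm p').1) - (hX (liftMap π ι p').1 - hX ((liftEquiv (τ μ) ι).symm (liftMap π ι p')).1)| ≤ o₀)
    (hA' : ∀ j x' i, ∑ k, |tCoefA η' R' j x' i k| ≤ rA) (hfA : ∀ j x' i, ∑ k, |tCoefA η' R' j x' i k - tCoefA η R j (π x') i k| ≤ oA)
    (hG : HasMaj (BlockNorm.ofBlocks g (liftBlk blk ι)) (BlockNorm.ofBlocks g (liftBlk blk ι)) G (fun y y' => ind S y * ind S y' * (β * Real.exp (-(δ * g.dist y y')))))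
    (hD : ∀ μ, HasMaj (BlockNorm.ofBlocks g (liftBlk blk ι)) (BlockNorm.ofBlocks g (liftBlk blk ι)) (fgrad η⁻¹ (liftEquiv (τ μ) ι) ∘ₗ G)
      (fun y y' => ind S y * ind S y' * (β₁ * Real.exp (-(δ * g.dist y y')))))
    (hDb : ∀ μ, HasMaj (BlockNorm.ofBlocks g (liftBlk blk ι)) (BlockNorm.ofBlocks g (liftBlk blk ι)) (bgrad η⁻¹ (liftEquiv (τ μ) ι) ∘ₗ G)
      (fun y y' => ind S y * ind S y' * (β₁ * Real.exp (-(δ * g.dist y y')))))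
    (hDG : HasMaj (BlockNorm.ofBlocks g (liftBlk blk ι)) (BlockNorm.ofBlocks g (liftBlk blk ι ∘ liftMap π ι)) (idef (pull (liftMap π ι)) (pull (liftMap π ι)) G' G)
      (fun y y' => ind S y * ind S y' * (m₀ * Real.exp (-(δ * g.dist y y')))))
    (hDD : ∀ μ, HasMaj (BlockNorm.ofBlocks g (liftBlk blk ι)) (BlockNorm.ofBlocks g (liftBlk blk ι ∘ liftMap π ι))
      (idef (pull (liftMap π ι)) (pull (liftMap π ι)) (fgrad η'⁻¹ (liftEquiv (τ' μ) ι) ∘ₗ G') (fgrad η⁻¹ (liftEquiv (τ μ) ι) ∘ₗ G))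
      (fun y y' => ind S y * ind S y' * (m₁ * Real.exp (-(δ * g.dist y y')))))
    (hDDb : ∀ μ, HasMaj (BlockNorm.ofBlocks g (liftBlk blk ι)) (BlockNorm.ofBlocks g (liftBlk blk ι ∘ liftMap π ι))
      (idef (pull (liftMap π ι)) (pull (liftMap π ι)) (bgrad η'⁻¹ (liftEquiv (τ' μ) ι) ∘ₗ G') (bgrad η⁻¹ (liftEquiv (τ μ) ι) ∘ₗ G))
      (fun y y' => ind S y * ind S y' * (m₁ * Real.exp (-(δ * g.dist y y'))))) :
    HasMaj (BlockNorm.ofBlocks g (liftBlk blk ι)) (BlockNorm.ofBlocks g (liftBlk blk ι ∘ liftMap π ι))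
      (idef (pull (liftMap π ι)) (pull (liftMap π ι)) (commOp (covLapM τ' η' R') (fun p' : X' × ι => hX' p'.1) ∘ₗ G') (commOp (covLapM τ η R) (fun p : X × ι => hX p.1) ∘ₗ G))
      (fun y y' => ind S y * ind S y' *
        ((Fintype.card J * (c₂ * m₀ + o₂ * β + 2 * (c₁ * m₁ + o₁ * β₁) + 2 * (rA * (c₁ * m₀ + o₁ * β + c₀ * m₁ + o₀ * β₁) + oA * (c₁ * β + c₀ * β₁)))) *
          Real.exp (-(δ * g.dist y y')))) := by
  have hDW := hasMaj_idef_commOp_neg_speciesOpM_comp blk π τ τ' η⁻¹ η'⁻¹ (tCoefC η R) (tCoefC η' R') (tCoefA η R) (tCoefA η' R') hX hX' G G' hc₁ hc₀ ho₁ ho₀ hrA hoA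
    hh1 hh1b hh0 hh0b hh1' hh1b' hh0' hh0b' hf1 hf1b hf0 hf0b hA' hfA hG hD hDb hDG hDD hDDb
  rw [covLapM_eq_lapOp, covLapM_eq_lapOp]
  refine (hasMaj_idef_commOp_lapOp_comp (liftBlk blk ι) (liftMap π ι) (e := fun μ => liftEquiv (τ μ) ι) (e' := fun μ => liftEquiv (τ' μ) ι) hc₁ hc₂ ho₁ ho₂
    hh1' hh1b' hh2' hf1 hf1b hf2 hG hD hDb hDG hDD hDDb hDW).mono fun y y' => le_of_eq ?_
  ring

end CovariantRows

end Summit.QuantumFields.YangMills.BalabanUVNodes.N15.CurvedSpecies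

end
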